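/-
Origin: expansion seat `planner-pub-hodgecm-pv06-g2-0`, handover 2026-08-18T04:57:56Z (`HOME/pub-hodgecm-pv06-g2/lean/Pv06g2/CharSeparationCorollaries.lean`, md5 68e27830, 47 lines);
landed by the gen-6 packager in gate run 22 as `HodgeCM/PerL34/CharSeparationCorollaries.lean` (import ^import Pv[0-9]+g[0-9]+\.→import HodgeCM.PerL34. ×1).
-/
/-
Origin: HOME/pub-hodgecm-pv06-g2/lean/Pv06g2/CharSeparationCorollaries.lean — session planner-pub-hodgecm-pv06-g2-0 (unit
pub-hodgecm-pv06-g2, DAG-NODE PROVER #06 gen 2).  Intended final place: `HodgeCM/PerL34/CharSeparationCorollaries.lean`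
(rename `import Pv06g2.CharSeparation` ↦ `import HodgeCM.PerL34.CharSeparation`; lands AFTER `CharSeparation.lean` and after
the run-21 file `HodgeCM/PerL34/CharCompleteness.lean`).  Closed; axioms = standard trio.
-/
import Summits.HodgeConjecture.HodgeCM.PerL34.CharSeparation_2
import Summits.HodgeConjecture.HodgeCM.PerL34.CharCompleteness

set_option autoImplicit false

/-!
# By-name discharge of the `hsep` hypothesis of `CharCompleteness` (node N23c, `fourier` residual)

`CharCompleteness.eq_zero_of_forall_character_orthogonal` (pv06 gen 1, run 21) carried the PRINT hypothesis
`hsep : ∀ k₁ k₂ : K, k₁ ≠ k₂ → ∃ χ : PontryaginDual K, χ k₁ ≠ χ k₂`.  For `K` compact Hausdorff ABELIAN it is now the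
kernel theorem `CharSeparation.charSeparating`, so Fourier completeness on `[T]` (PerL v5 l. 425: "by completeness of
characters of the compact abelian group `[T]`") holds with NO non-Mathlib input.  (pv11's `SupplyElementary.CharSeparating G`
is the same statement by `def`inition: pass `CharSeparation.charSeparating` for its `hsep`.)
-/

noncomputable section

namespace HodgeCM
namespace PerL34
namespace CharSeparation

open MeasureTheory

/-- **Fourier completeness on a compact abelian group, unconditional.**  If all Fourier coefficients
`∫ conj(χ)·x dμ` of a continuous `x` vanish (`μ` finite, positive on opens), then `x = 0`. -/
theorem eq_zero_of_forall_character_orthogonal {K : Type*} [CommGroup K] [TopologicalSpace K]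
    [IsTopologicalGroup K] [CompactSpace K] [T2Space K] [MeasurableSpace K] [OpensMeasurableSpace K]
    (μ : Measure K) [IsFiniteMeasure μ] [μ.IsOpenPosMeasure] (x : C(K, ℂ))
    (horth : ∀ χ : PontryaginDual K, ∫ k, star ((χ k : Circle) : ℂ) * x k ∂μ = 0) : x = 0 :=
  CharCompleteness.eq_zero_of_forall_character_orthogonal μ charSeparating x horth

/-- The separation statement in the binder shape `∀ k₁ k₂, k₁ ≠ k₂ → …` under the name used by the consumers. -/
theorem hsep {K : Type*} [CommGroup K] [TopologicalSpace K] [IsTopologicalGroup K] [CompactSpace K] [T2Space K] :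
    ∀ k₁ k₂ : K, k₁ ≠ k₂ → ∃ χ : PontryaginDual K, χ k₁ ≠ χ k₂ :=
  charSeparating

end CharSeparation
end PerL34
end HodgeCM

end
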